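import Summits.Ventures.GridStability.Models.StructurePreservingDAELocalMin
import Literature.Analysis.ODE.StrictMinimumCurveStability
import HarnessLib

/-!
# GridStability/Models/StructurePreservingDAEStability — Liapunov STABILITY of the operating point of
# MODEL MV-4, modulo the uniform rotation, w.r.t. DAE motions with smooth positive voltages (the «DAE
# soundness lemma» of MODEL-VALIDITY MV-4 (c)(ii), kernel-checked)

LADDER-GRIDFUSION G3 (model register), seat gridfusion-model-2 (g9); `plan/MODEL-VALIDITY.md` row
**MV-4** (c). Inputs: `StructurePreservingDAELocalMin.lean` (strict minimum on the pinned slice from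
a positive second variation), `StructurePreservingDAEHessian.lean` (rotation invariance of `W − W₁`),
`StructurePreservingDAEConservation.lean` (`dW/dt = −ΣDᵢ(ωᵢ−ω_s)² ≤ 0` along damped DAE motions,
`= 0` undamped) and the Literature lemma
`Literature.Analysis.ODE.StrictMinStability.forall_dist_lt_local` (Liapunov stability from a strict
local minimum, a priori form for curves [cite: HairerNorsettWanner1993, §I.13 Definition 13.1,
eqs (13.15)–(13.16)]).

## Contents (all PROVED; MODELLED column — statements about MODEL MV-4; no instance, no grid sentence)
* `PhaseSpace`, `pinnedState` — the state `(δ, ω, V, θ)` with all angles read relative to bus `k₀`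
  (held at its operating value): the frame in which the rotation zero mode is invisible;
* `IsSolution.isDampedSolution_zero` — the printed undamped model is the damped record with `D = 0`;
* `continuousOn_energy` — `W` is continuous on the region of positive voltages;
* `forall_dist_pinnedState_lt` — **Liapunov stability modulo rotation from a strict minimum on the
  slice**: for every `ε > 0` there is `η > 0` such that every damped (`Dᵢ ≥ 0`) DAE motion with
  differentiable bus variables and positive voltages [cite: Padiyar2013, §3.4.4 Comment 1] whose
  pinned initial state is `η`-close to the operating point keeps its pinned state `ε`-close for all
  `t ≥ 0`;
* `forall_dist_pinnedState_lt_of_hessianQuad_pos` — the two halves assembled: positive second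
  variation on the pinned directions (what an exact PD certificate of the pinned Hessian delivers on
  an instance) ⇒ Liapunov stability modulo rotation.
THREE COLUMNS: mathematics about MODEL MV-4 and perturbation class C = «DAE motions with C¹ positive
bus voltages»; existence of such motions (index-1 solvability along the motion) remains the printed
modelling assumption; nothing here is a sentence about a grid.
[cite: Padiyar2013, §3.4.4 eqs (3.32)–(3.41), Comment 1]; [cite: SauerPai1998, §9.8]
-/

noncomputable section

open Finset Real Set Metric Filter
open scoped Topology

namespace Summit.Ventures.GridStability.Models.StructurePreservingDAE.Params

variable {m n : ℕ}

/-! ### Liapunov stability of the operating point modulo the uniform rotation (pinned frame) -/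

/-- The phase space `(δ, ω, V, θ)` of the structure-preserving DAE with the sup norm
(machine angles, machine speeds, bus voltage magnitudes, bus angles). [cite: SauerPai1998, §7.9.2 eqs (7.193)–(7.196)] -/
abbrev PhaseSpace (m n : ℕ) : Type := (Fin m → ℝ) × (Fin m → ℝ) × (Fin n → ℝ) × (Fin n → ℝ)

/-- The **pinned state**: all machine and bus angles shifted by the common amount `θref − θ_{k₀}`,
so that bus `k₀` reads `θref` — the representative of the state modulo the uniform rotation
`(δ, θ) ↦ (δ + c, θ + c)` (the zero mode of `W`, `potential_rotate`). Speeds and voltages unchanged.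
[cite: Padiyar2013, §3.4.4 eq (3.32)] -/
def pinnedState (k₀ : Fin n) (θref : ℝ) (δ ω : Fin m → ℝ) (V θ : Fin n → ℝ) : PhaseSpace m n :=
  (fun i => δ i + (θref - θ k₀), ω, V, fun k => θ k + (θref - θ k₀))

/-- The undamped printed model is the damped record with `D = 0`. [cite: SauerPai1998, §7.9.2 eq (7.194)] -/
theorem IsSolution.isDampedSolution_zero {p : Params m n} {δ ω : ℝ → Fin m → ℝ}
    {V θ : ℝ → Fin n → ℝ} (h : p.IsSolution δ ω V θ) : p.IsDampedSolution 0 δ ω V θ where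
  differentiable_δ := h.differentiable_δ
  differentiable_ω := h.differentiable_ω
  angle := h.angle
  swing := fun t i => by rw [h.swing t i]; simp
  activeBalance := h.activeBalance
  reactiveBalance := h.reactiveBalance

/-- The energy, read on the phase space, is continuous on the region of positive voltages (constant
active loads, reactive characteristics continuous on `(0, ∞)`). [cite: Padiyar2013, §3.4.4 eq (3.32), Comment 1] -/
theorem continuousOn_energy {p : Params m n} {Vs : Fin n → ℝ} (hVs : ∀ k, 0 < Vs k)
    (hPL : ∀ k v, p.PL k v = p.PL k (Vs k)) (hQL : ∀ k, ContinuousOn (p.QL k) (Ioi 0)) :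
    ContinuousOn (fun x : PhaseSpace m n => p.energy Vs x.1 x.2.1 x.2.2.1 x.2.2.2)
      {x | ∀ k, 0 < x.2.2.1 k} := by
  have hsmooth : Continuous fun x : PhaseSpace m n =>
      p.kinetic x.2.1 - ∑ i, p.TM i * x.1 i + p.machineEnergy x.1 x.2.2.1 x.2.2.2
        + p.networkEnergy x.2.2.1 x.2.2.2 - ∑ k, p.PL k (Vs k) * x.2.2.2 k := by
    unfold kinetic machineEnergy networkEnergy
    fun_prop
  have hint : ContinuousOn (fun x : PhaseSpace m n => ∑ k, ∫ v in Vs k..x.2.2.1 k, p.QL k v / v)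
      {x | ∀ k, 0 < x.2.2.1 k} := by
    refine continuousOn_finsetSum _ fun k _ x hx => ?_
    have hproj : Continuous fun y : PhaseSpace m n => y.2.2.1 k := by fun_prop
    have hF : HasDerivAt (fun w : ℝ => ∫ v in Vs k..id w, p.QL k v / v)
        (p.QL k (id (x.2.2.1 k)) / id (x.2.2.1 k) * 1) (x.2.2.1 k) :=
      hasDerivAt_reactiveIntegral (hQL k) (hVs k) (hasDerivAt_id _) (by simpa using hx k)
    have hc : ContinuousAt (fun y : PhaseSpace m n => ∫ v in Vs k..id (y.2.2.1 k), p.QL k v / v) x :=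
      ContinuousAt.comp (f := fun y : PhaseSpace m n => y.2.2.1 k)
        (g := fun w : ℝ => ∫ v in Vs k..id w, p.QL k v / v) hF.continuousAt hproj.continuousAt
    simpa using hc.continuousWithinAt
  refine ((hsmooth.continuousOn.sub hint).congr fun x _ => ?_)
  simp only [energy, Pi.sub_apply]
  have : ∑ k, p.PL k (x.2.2.1 k) * x.2.2.2 k = ∑ k, p.PL k (Vs k) * x.2.2.2 k :=
    Finset.sum_congr rfl fun k _ => by rw [hPL k]
  rw [this]

/-- **Liapunov stability of the operating point of MODEL MV-4, modulo the uniform rotation, from a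
strict minimum of the energy on the pinned slice.** `p` well formed, `(δ*, V*, θ*)` an operating point
with `V* > 0`, constant active loads, reactive characteristics continuous on `(0, ∞)`; suppose `W`
(reference voltages `V*`) is STRICTLY larger than at `x* = (δ*, ω_s, V*, θ*)` at every other state of
the slice `{θ_{k₀} = θ*_{k₀}}` within sup-distance `r` (`0 < r < min_k V*_k`). Then for every `ε > 0`
there is `η > 0` such that for every damping `D ≥ 0` and every motion of the damped DAE
(`IsDampedSolution`; `D = 0` is the printed model) with differentiable bus variables and positive
voltages [cite: Padiyar2013, §3.4.4 Comment 1], if the pinned initial state is within `η` of `x*`,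
the pinned state stays within `ε` of `x*` for all `t ≥ 0`. Mechanism: `W` is rotation invariant
(`potential_rotate_of_isOperatingPoint`), so `W(pinned state) = W(state)`, which does not increase
(`hasDerivAt_energy_damped`: `dW/dt = −ΣDᵢ(ωᵢ−ω_s)² ≤ 0`); then
`Literature.Analysis.ODE.StrictMinStability.forall_dist_lt_local`.
[cite: HairerNorsettWanner1993, §I.13 Definition 13.1, eqs (13.15)–(13.16)]; [cite: Padiyar2013, §3.4.4 eqs (3.32)–(3.40)] -/
theorem forall_dist_pinnedState_lt {p : Params m n} (hp : p.WellFormed)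
    {δs : Fin m → ℝ} {Vs θs : Fin n → ℝ} (hop : p.IsOperatingPoint δs Vs θs) (hVs : ∀ k, 0 < Vs k)
    (hPL : ∀ k v, p.PL k v = p.PL k (Vs k)) (hQL : ∀ k, ContinuousOn (p.QL k) (Ioi 0))
    (k₀ : Fin n) {r : ℝ} (hr : 0 < r) (hrV : ∀ k, r < Vs k)
    (hmin : ∀ x : PhaseSpace m n, x.2.2.2 k₀ = θs k₀ →
      dist x ((δs, fun _ => p.ωs, Vs, θs) : PhaseSpace m n) ≤ r →
      x ≠ ((δs, fun _ => p.ωs, Vs, θs) : PhaseSpace m n) →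
      p.energy Vs δs (fun _ => p.ωs) Vs θs < p.energy Vs x.1 x.2.1 x.2.2.1 x.2.2.2)
    {ε : ℝ} (hε : 0 < ε) :
    ∃ η > 0, ∀ (D : Fin m → ℝ) (δ ω : ℝ → Fin m → ℝ) (V θ : ℝ → Fin n → ℝ),
      (∀ i, 0 ≤ D i) → p.IsDampedSolution D δ ω V θ →
      (∀ k, Differentiable ℝ fun t => V t k) → (∀ k, Differentiable ℝ fun t => θ t k) →
      (∀ t k, 0 < V t k) →
      dist (pinnedState k₀ (θs k₀) (δ 0) (ω 0) (V 0) (θ 0))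
        ((δs, fun _ => p.ωs, Vs, θs) : PhaseSpace m n) < η →
      ∀ t, 0 ≤ t → dist (pinnedState k₀ (θs k₀) (δ t) (ω t) (V t) (θ t))
        ((δs, fun _ => p.ωs, Vs, θs) : PhaseSpace m n) < ε := by
  set xs : PhaseSpace m n := (δs, fun _ => p.ωs, Vs, θs) with hxsdef
  set P : Set (PhaseSpace m n) := {x | x.2.2.2 k₀ = θs k₀} with hPdef
  have hPc : IsClosed P := isClosed_eq (by fun_prop) continuous_const
  have hxsP : xs ∈ P := by simp [hPdef, hxsdef]
  set E : PhaseSpace m n → ℝ := fun x => p.energy Vs x.1 x.2.1 x.2.2.1 x.2.2.2 with hEdef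
  -- on `closedBall xs r` all voltages are positive, so `E` is continuous there
  have hball : ∀ x : PhaseSpace m n, dist x xs ≤ r → ∀ k, 0 < x.2.2.1 k := by
    intro x hx k
    have e1 : dist (x.2.2.1 k) (xs.2.2.1 k) ≤ dist x.2.2.1 xs.2.2.1 := dist_le_pi_dist _ _ k
    have e2 : dist x.2.2.1 xs.2.2.1 ≤ dist x.2.2 xs.2.2 := by
      simpa only [Prod.dist_eq] using le_max_left (dist x.2.2.1 xs.2.2.1) (dist x.2.2.2 xs.2.2.2)
    have e3 : dist x.2.2 xs.2.2 ≤ dist x.2 xs.2 := by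
      simpa only [Prod.dist_eq] using le_max_right (dist x.2.1 xs.2.1) (dist x.2.2 xs.2.2)
    have e4 : dist x.2 xs.2 ≤ dist x xs := by
      simpa only [Prod.dist_eq] using le_max_right (dist x.1 xs.1) (dist x.2 xs.2)
    have h1 : dist (x.2.2.1 k) (Vs k) ≤ r := by
      have : xs.2.2.1 k = Vs k := rfl
      rw [← this]
      linarith
    rw [Real.dist_eq] at h1
    have := (abs_le.1 h1).1
    linarith [hrV k]
  have hEc : ContinuousOn E (P ∩ closedBall xs r) :=
    (continuousOn_energy hVs hPL hQL).mono fun x hx => hball x (mem_closedBall.1 hx.2)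
  have hmin' : ∀ x ∈ P, dist x xs ≤ r → x ≠ xs → E xs < E x := fun x hx hd hne => hmin x hx hd hne
  obtain ⟨η, hη, hstab⟩ :=
    Literature.Analysis.ODE.StrictMinStability.forall_dist_lt_local hPc hxsP hr hEc hmin' hε
  refine ⟨η, hη, fun D δ ω V θ hD hsol hVd hθd hVpos h0 t ht => ?_⟩
  set γ : ℝ → PhaseSpace m n := fun s => pinnedState k₀ (θs k₀) (δ s) (ω s) (V s) (θ s) with hγdef
  have hδc : ∀ i, Continuous fun s => δ s i := fun i => (hsol.differentiable_δ i).continuous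
  have hωc : ∀ i, Continuous fun s => ω s i := fun i => (hsol.differentiable_ω i).continuous
  have hVc : ∀ k, Continuous fun s => V s k := fun k => (hVd k).continuous
  have hθc : ∀ k, Continuous fun s => θ s k := fun k => (hθd k).continuous
  have hγc : Continuous γ := by
    simp only [hγdef, pinnedState]
    refine ((continuous_pi fun i => (hδc i).add (continuous_const.sub (hθc k₀))).prodMk
      ((continuous_pi hωc).prodMk ((continuous_pi hVc).prodMk
        (continuous_pi fun k => (hθc k).add (continuous_const.sub (hθc k₀))))))
  have hγP : ∀ s, 0 ≤ s → γ s ∈ P := fun s _ => by simp [hγdef, hPdef, pinnedState]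
  -- the energy of the pinned state is the energy of the state (rotation invariance) …
  have hEγ : ∀ s, E (γ s) = p.energy Vs (δ s) (ω s) (V s) (θ s) := by
    intro s
    simp only [hEdef, hγdef, pinnedState]
    rw [energy_eq_kinetic_add_potential, energy_eq_kinetic_add_potential,
      potential_rotate_of_isOperatingPoint hp hop hPL]
  -- … which does not increase along the motion
  have hmono : ∀ s, 0 ≤ s → E (γ s) ≤ E (γ 0) := by
    intro s hs
    rw [hEγ, hEγ]
    refine Literature.Analysis.ODE.StrictMinStability.apply_le_apply_zero_of_hasDerivAt_nonpos
      (g := fun s => p.energy Vs (δ s) (ω s) (V s) (θ s))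
      (g' := fun s => -∑ i, D i * (ω s i - p.ωs) ^ 2)
      (fun τ _ => hasDerivAt_energy_damped hp.B_symm hsol hVd hθd hVpos hVs hPL hQL τ)
      (fun τ _ => ?_) hs
    simp only [neg_nonpos]
    exact Finset.sum_nonneg fun i _ => mul_nonneg (hD i) (sq_nonneg _)
  exact hstab γ hγc.continuousOn hγP h0 (fun s hs _ => hmono s hs) t ht

/-- **From a positive second variation on the pinned directions to Liapunov stability** (the two
halves assembled): `p` well formed, operating point with `V* > 0`, smooth loads, and `hessianQuad`
positive on every nonzero direction with `φ_{k₀} = 0` (this is what an exact positive-definiteness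
certificate of the pinned Hessian delivers on an instance). Then the operating point of MODEL MV-4 is
Liapunov-stable modulo the uniform rotation with respect to the class of damped (`D ≥ 0`, incl. the
printed undamped) DAE motions with differentiable bus variables and positive voltages: pinned states
that start `η`-close to `x*` stay `ε`-close. [cite: Padiyar2013, §3.4.4 eqs (3.32)–(3.40), Comment 1];
[cite: HairerNorsettWanner1993, §I.13 Definition 13.1, eqs (13.15)–(13.17)] -/
theorem forall_dist_pinnedState_lt_of_hessianQuad_pos {p : Params m n} (hp : p.WellFormed)
    {δs : Fin m → ℝ} {Vs θs : Fin n → ℝ} (hop : p.IsOperatingPoint δs Vs θs) (hVs : ∀ k, 0 < Vs k)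
    {QL' : Fin n → ℝ → ℝ} (hL : p.SmoothLoads Vs QL') (k₀ : Fin n)
    (hpos : ∀ (a : Fin m → ℝ) (u φ : Fin n → ℝ), φ k₀ = 0 → (a, u, φ) ≠ 0 →
      0 < p.hessianQuad QL' δs a Vs θs u φ) {ε : ℝ} (hε : 0 < ε) :
    ∃ η > 0, ∀ (D : Fin m → ℝ) (δ ω : ℝ → Fin m → ℝ) (V θ : ℝ → Fin n → ℝ),
      (∀ i, 0 ≤ D i) → p.IsDampedSolution D δ ω V θ →
      (∀ k, Differentiable ℝ fun t => V t k) → (∀ k, Differentiable ℝ fun t => θ t k) →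
      (∀ t k, 0 < V t k) →
      dist (pinnedState k₀ (θs k₀) (δ 0) (ω 0) (V 0) (θ 0))
        ((δs, fun _ => p.ωs, Vs, θs) : PhaseSpace m n) < η →
      ∀ t, 0 ≤ t → dist (pinnedState k₀ (θs k₀) (δ t) (ω t) (V t) (θ t))
        ((δs, fun _ => p.ωs, Vs, θs) : PhaseSpace m n) < ε := by
  obtain ⟨r₁, hr₁, hlt⟩ := energy_lt_of_hessianQuad_pos hp hop hVs hL k₀ hpos
  -- a positive lower bound for the operating voltages
  obtain ⟨v₀, hv₀, hv⟩ : ∃ v₀ > 0, ∀ k, v₀ ≤ Vs k := by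
    rcases isEmpty_or_nonempty (Fin n) with h | h
    · exact ⟨1, one_pos, fun k => (IsEmpty.false k).elim⟩
    · obtain ⟨k₁, -, hk₁⟩ := Finset.exists_min_image Finset.univ Vs Finset.univ_nonempty
      exact ⟨Vs k₁, hVs k₁, fun k => hk₁ k (Finset.mem_univ k)⟩
  set r := min (r₁ / 2) (v₀ / 2) with hrdef
  have hr : 0 < r := lt_min (by linarith) (by linarith)
  have hrV : ∀ k, r < Vs k := fun k => lt_of_le_of_lt (min_le_right _ _) (by linarith [hv k])
  have hrr₁ : r < r₁ := lt_of_le_of_lt (min_le_left _ _) (by linarith)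
  refine forall_dist_pinnedState_lt hp hop hVs hL.PL_const hL.QL_continuousOn k₀ hr hrV
    (fun x hxP hxd hne => ?_) hε
  set xs : PhaseSpace m n := (δs, fun _ => p.ωs, Vs, θs) with hxsdef
  -- the displacement from the operating point is a pinned nonzero direction of norm `≤ r < r₁`
  have hφ : (x.2.2.2 - θs) k₀ = 0 := by simp [hxP]
  have hne' : ((x.1 - δs, x.2.1 - fun _ => p.ωs, x.2.2.1 - Vs, x.2.2.2 - θs) : PhaseSpace m n) ≠ 0 := by
    intro h
    obtain ⟨h1, h2, h3, h4⟩ : x.1 - δs = 0 ∧ (x.2.1 - fun _ => p.ωs) = 0 ∧ x.2.2.1 - Vs = 0 ∧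
        x.2.2.2 - θs = 0 := by simpa only [Prod.mk_eq_zero] using h
    apply hne
    rw [hxsdef]
    exact Prod.ext (sub_eq_zero.1 h1) (Prod.ext (sub_eq_zero.1 h2)
      (Prod.ext (sub_eq_zero.1 h3) (sub_eq_zero.1 h4)))
  have hnorm : ‖((x.1 - δs, x.2.1 - fun _ => p.ωs, x.2.2.1 - Vs, x.2.2.2 - θs) : PhaseSpace m n)‖
      < r₁ := by
    have : ((x.1 - δs, x.2.1 - fun _ => p.ωs, x.2.2.1 - Vs, x.2.2.2 - θs) : PhaseSpace m n)
        = x - xs := by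
      rw [hxsdef]
      exact Prod.ext (by simp) (Prod.ext (by simp) (Prod.ext (by simp) (by simp)))
    rw [this, ← dist_eq_norm]
    exact lt_of_le_of_lt hxd hrr₁
  have h := hlt (x.1 - δs) (x.2.1 - fun _ => p.ωs) (x.2.2.1 - Vs) (x.2.2.2 - θs) hφ hne' hnorm
  simpa using h

end Summit.Ventures.GridStability.Models.StructurePreservingDAE.Params

end
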